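import Mathlib
import HarnessLib
import Literature.Analysis.FluidPDE.ClassicalSolution
import Literature.Analysis.FluidPDE.LerayHopf
import Literature.Analysis.FluidPDE.TaoLocalisationHolds
import Literature.Analysis.FluidPDE.TaoFiniteEnergyLerayHopf
import Summits.NavierStokesRegularity.NavierStokesRegularity.Theorems.QuarterJoltTerminalPairingStatic
import Summits.NavierStokesRegularity.NavierStokesRegularity.Theorems.QuarterJoltEnergyJumpLaw
import Summits.NavierStokesRegularity.NavierStokesRegularity.Theorems.QuarterJoltEnergyJumpDefect
import Summits.NavierStokesRegularity.NavierStokesRegularity.Theorems.CertifiedBlowupCertifiedBlowupAxisymBlowupEnergyDrain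

/-!
# Route QuarterJolt — crux `NoTerminalJolt` (stmt-NavierStokesRegularity-26463), LEAD line
# `regular_split` rev 4: the PAIRING RATE, II — `∫⟪u(t) − u(T), u(T)⟫ = o(√(T−t))` against a regular
# terminal value

Seat ns-ntj-p1 g3 (LEAD of the crux; `--supports 26463 --as helper`), sequel of
`QuarterJoltTerminalPairingStatic.lean` (p634428); consumed by `QuarterJoltRegularTerminalValueJolts.lean`.

Frame: `(u,p)` classical on `[0,T)` (`ν, T > 0`), Leray–Hopf on `[0,T]` from a rapidly decaying datum;
`U := u(T)` the Leray–Hopf terminal value, assumed REGULAR: smooth (`C^∞`), bounded (`‖U‖ ≤ L`),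
divergence free, `DU ∈ L²` (`U ∈ L²` is automatic).

* `pair_increment_abs_le_slab` — on a closed slab `[0,S]` in Tao's class: polarisation
  `2⟪u(τ), U⟫ = ‖u(τ)‖² + ‖U‖² − ‖u(τ) − U‖²` and the tree's `L²` balance
  (`IsSmoothSpaceTimeOn.l2_balance`) for `u` and for `u − U` give
  `∫⟪u(s), U⟫ − ∫⟪u(t), U⟫ = ∫ₜˢ ∫⟪U, ∂ₜu(τ)⟫ dτ`; the static estimate
  `pairing_timeDeriv_abs_le_of_classical` bounds the integrand, whence for every `η > 0`
  `|∫⟪u(s), U⟫ − ∫⟪u(t), U⟫| ≤ ((ν+1)/2) η ∫ₜˢ∫|Du|²_F + ((ν∫|DU|²_F + L²I₀)/(2η))(s−t)`.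
* `pair_abs_le` — in the frame (`I₀ = 2E(u 0)`, slab `[0,(s+T)/2]` by
  `tao2011_hasBoundedSobolevNormsOn_holds`, then `s ↑ T` by weak continuity):
  `|∫⟪u(t) − u(T), u(T)⟫| ≤ ((ν+1)/2) η ∫ₜᵀ∫|Du|²_F + ((ν∫|Du(T)|²_F + 2L²E(u 0))/(2η))(T−t)`.
(The rate `o(√(T−t))` itself, `pair_isLittleO`, is in `QuarterJoltRegularTerminalValueJolts.lean`.)

HONEST FRAMING: a priori estimates for classical Leray–Hopf solutions with a (hypothetically) regular
terminal value; nothing here concerns the truth of `NoTerminalJolt` or Navier–Stokes regularity. No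
summit statement is proved here. [folklore]
-/

noncomputable section

-- the summit and its single sub-problem share the name (CONVENTIONS §1), as in every Theorems file
set_option linter.dupNamespace false

namespace Summit.NavierStokesRegularity.NavierStokesRegularity.Theorems

open MeasureTheory Set Function Filter Topology InnerProductSpace
open scoped ENNReal NNReal ContDiff RealInnerProductSpace
open Literature.Analysis.FluidPDE

namespace NoTerminalJolt

/-! ### The pairing increment on a closed slab -/

/-- **The pairing increment identity and estimate on a closed slab.** Let `(u,p)` be a classical
solution of unforced Navier–Stokes on `[0,S] × ℝ³` (`ν, S > 0`) in Tao's class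
(`HasBoundedSobolevNormsOn`), with `∫‖u(τ)‖² ≤ I₀` on `[0,S]`, and let `U ∈ C^∞` be divergence free
with `‖U‖ ≤ L`, `U, DU ∈ L²`. Then for `0 < t < s ≤ S'< S` … precisely for `0 < t < s < S` and every
`η > 0`: `|∫⟪u(s), U⟫ − ∫⟪u(t), U⟫| ≤ ((ν+1)/2) η (∫⁻_{(t,s)}∫⁻|Du|²_F).toReal +
((ν∫|DU|²_F + L²I₀)/(2η)) (s − t)`. [folklore] -/
theorem pair_increment_abs_le_slab {ν S : ℝ} (hν : 0 < ν) (hS : 0 < S)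
    {u : ℝ → EuclideanSpace ℝ (Fin 3) → EuclideanSpace ℝ (Fin 3)} {p : ℝ → EuclideanSpace ℝ (Fin 3) → ℝ}
    (hsol : IsClassicalNSSolutionOn (Icc 0 S) ν 0 u p) (hB : HasBoundedSobolevNormsOn (Icc 0 S) u)
    {I₀ : ℝ} (hI₀le : ∀ t ∈ Icc 0 S, ∫ x, ‖u t x‖ ^ 2 ≤ I₀)
    {U : EuclideanSpace ℝ (Fin 3) → EuclideanSpace ℝ (Fin 3)} (hUs : ContDiff ℝ ∞ U)
    (hdivU : VectorCalculus.IsDivFree U) {L : ℝ} (hL : ∀ x, ‖U x‖ ≤ L)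
    (l2U : ∫⁻ x, ‖U x‖ₑ ^ 2 < ⊤) (l2DU : ∫⁻ x, ‖fderiv ℝ U x‖ₑ ^ 2 < ⊤)
    {t s : ℝ} (ht : 0 < t) (hts : t < s) (hsS : s < S) {η : ℝ} (hη : 0 < η) :
    |(∫ x, ⟪u s x, U x⟫) - ∫ x, ⟪u t x, U x⟫| ≤
      (ν + 1) / 2 * η *
          (∫⁻ τ in Ioo t s, ∫⁻ x, ENNReal.ofReal (frobeniusNormSq (fderiv ℝ (u τ) x))).toReal +
        (ν * (∫ x, frobeniusNormSq (fderiv ℝ U x)) + L ^ 2 * I₀) / (2 * η) * (s - t) := by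
  have hUI : UniqueDiffOn ℝ (Icc 0 S) := uniqueDiffOn_Icc hS
  have hu : ∀ τ ∈ Icc 0 S, ContDiff ℝ ∞ (u τ) := fun τ hτ => hsol.contDiff_velocity hτ
  have hU1 : ContDiff ℝ 1 U := hUs.of_le (by norm_cast)
  have cU : Continuous U := hUs.continuous
  have hmU : MemLp U 2 volume := memLp_two_of_lintegral_lt_top cU l2U
  -- Sobolev data of the slices
  obtain ⟨C₀, hC₀⟩ := hB 0
  have hzero : ∀ σ ∈ Icc 0 S, ∫⁻ x, ‖u σ x‖ₑ ^ 2 ≤ C₀ := fun σ hσ => by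
    refine (le_of_eq (lintegral_congr fun x => ?_)).trans (hC₀ σ hσ)
    rw [← ofReal_norm, ← ofReal_norm, norm_iteratedFDeriv_zero]
  have l2sl : ∀ τ ∈ Icc 0 S, ∫⁻ x, ‖u τ x‖ₑ ^ 2 < ⊤ := fun τ hτ =>
    (hzero τ hτ).trans_lt ENNReal.coe_lt_top
  have cut : ∀ τ ∈ Icc 0 S, Continuous (u τ) := fun τ hτ => (hu τ hτ).continuous
  have hmu : ∀ τ ∈ Icc 0 S, MemLp (u τ) 2 volume := fun τ hτ =>
    memLp_two_of_lintegral_lt_top (cut τ hτ) (l2sl τ hτ)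
  -- the time derivative and its `L²` bound
  obtain ⟨Λ, hΛtop, hΛ⟩ := hsol.exists_lintegral_enorm_timeDerivWithin_sq_le hν.le hS hB
  set W : ℝ → EuclideanSpace ℝ (Fin 3) → EuclideanSpace ℝ (Fin 3) := timeDerivWithin (Icc 0 S) u
    with hWdef
  have hWsm : IsSmoothSpaceTimeOn (Icc 0 S) W := hsol.smooth_velocity.timeDerivWithin hUI
  have cWt : ∀ τ ∈ Icc 0 S, Continuous (W τ) := fun τ hτ => (hWsm.contDiff_slice hτ).continuous
  have l2Wt : ∀ τ ∈ Icc 0 S, ∫⁻ x, ‖W τ x‖ₑ ^ 2 < ⊤ := fun τ hτ => (hΛ τ hτ).trans_lt hΛtop.lt_top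
  -- (1) the `L²` balance of `u`
  have hC₁u : ∀ τ ∈ Icc 0 S, ∫⁻ x, ‖timeDerivWithin (Icc 0 S) u τ x‖ₑ ^ 2 ≤ Λ.toNNReal := by
    intro τ hτ; rw [ENNReal.coe_toNNReal hΛtop]; exact hΛ τ hτ
  obtain ⟨hΦu_int, -, hEu⟩ := hsol.smooth_velocity.l2_balance hS hzero hC₁u
  -- (2) the `L²` balance of `w = u − U`
  obtain ⟨w, hwdef⟩ : ∃ w : ℝ → EuclideanSpace ℝ (Fin 3) → EuclideanSpace ℝ (Fin 3),
      w = fun τ x => u τ x - U x := ⟨_, rfl⟩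
  have hwtx : ∀ τ x, w τ x = u τ x - U x := fun τ x => by rw [hwdef]
  have hconst : IsSmoothSpaceTimeOn (Icc 0 S) (fun (_ : ℝ) (x : EuclideanSpace ℝ (Fin 3)) => U x) := by
    have hc : ContDiff ℝ ∞ (uncurry fun (_ : ℝ) (x : EuclideanSpace ℝ (Fin 3)) => U x) :=
      hUs.comp contDiff_snd
    exact hc.contDiffOn
  have hwsm : IsSmoothSpaceTimeOn (Icc 0 S) w := by
    rw [hwdef]; exact hsol.smooth_velocity.sub hconst
  have hWt : ∀ τ ∈ Icc 0 S, ∀ x, timeDerivWithin (Icc 0 S) w τ x = W τ x := by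
    intro τ hτ x
    rw [hwdef, hsol.smooth_velocity.timeDerivWithin_fun_sub hconst hUI hτ x]
    simp [hWdef, timeDerivWithin_apply]
  have hwL2 : ∀ τ ∈ Icc 0 S, ∫⁻ x, ‖w τ x‖ₑ ^ 2 ≤ (2 * C₀ + 2 * (∫⁻ x, ‖U x‖ₑ ^ 2).toNNReal : ℝ≥0) := by
    intro τ hτ
    have h := lintegral_enorm_sq_sub_le (g := U) ((cut τ hτ).aestronglyMeasurable) (μ := volume)
    calc ∫⁻ x, ‖w τ x‖ₑ ^ 2 = ∫⁻ x, ‖u τ x - U x‖ₑ ^ 2 := lintegral_congr fun x => by rw [hwtx]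
      _ ≤ 2 * (∫⁻ x, ‖u τ x‖ₑ ^ 2) + 2 * ∫⁻ x, ‖U x‖ₑ ^ 2 := h
      _ ≤ 2 * (C₀ : ℝ≥0∞) + 2 * ((∫⁻ x, ‖U x‖ₑ ^ 2).toNNReal : ℝ≥0∞) := by
          gcongr
          · exact hzero τ hτ
          · exact le_of_eq (ENNReal.coe_toNNReal l2U.ne).symm
      _ = ((2 * C₀ + 2 * (∫⁻ x, ‖U x‖ₑ ^ 2).toNNReal : ℝ≥0) : ℝ≥0∞) := by push_cast; rfl
  have hWL2 : ∀ τ ∈ Icc 0 S, ∫⁻ x, ‖timeDerivWithin (Icc 0 S) w τ x‖ₑ ^ 2 ≤ Λ.toNNReal := by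
    intro τ hτ
    rw [ENNReal.coe_toNNReal hΛtop]
    refine (le_of_eq (lintegral_congr fun x => ?_)).trans (hΛ τ hτ)
    rw [hWt τ hτ x]
  obtain ⟨hΦw_int, -, hEw⟩ := hwsm.l2_balance hS hwL2 hWL2
  -- names
  set Φu : ℝ → ℝ := fun τ => ∫ x, 2 * ⟪u τ x, timeDerivWithin (Icc 0 S) u τ x⟫ with hΦu
  set Φw : ℝ → ℝ := fun τ => ∫ x, 2 * ⟪w τ x, timeDerivWithin (Icc 0 S) w τ x⟫ with hΦw
  set Ψ : ℝ → ℝ := fun τ => (Φu τ - Φw τ) / 2 with hΨ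
  set P : ℝ → ℝ := fun τ => ∫ x, ⟪u τ x, U x⟫ with hP
  have hΨ_int : IntegrableOn Ψ (Ioo 0 S) := (hΦu_int.sub hΦw_int).div_const 2
  -- polarisation: `P τ = (∫‖u τ‖² + ∫‖U‖² − ∫‖w τ‖²)/2` on `[0,S]`
  have hpol : ∀ τ ∈ Icc 0 S, P τ = ((∫ x, ‖u τ x‖ ^ 2) + (∫ x, ‖U x‖ ^ 2) - ∫ x, ‖w τ x‖ ^ 2) / 2 := by
    intro τ hτ
    have h := integral_norm_sub_sq_eq (hmu τ hτ) hmU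
    have hw' : ∫ x, ‖w τ x‖ ^ 2 = ∫ x, ‖u τ x - U x‖ ^ 2 :=
      integral_congr_ae (Eventually.of_forall fun x => by simp only [hwtx])
    simp only [hP]
    rw [hw', h]
    ring
  -- the increment identity `P b − P 0 = ∫₀ᵇ Ψ` for `b ∈ (0,S]`
  have hincr : ∀ b ∈ Ioc 0 S, P b - P 0 = ∫ τ in (0 : ℝ)..b, Ψ τ := by
    intro b hb
    have h0 : (0 : ℝ) ∈ Icc 0 S := ⟨le_rfl, hS.le⟩
    have hbI : b ∈ Icc 0 S := ⟨hb.1.le, hb.2⟩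
    have e1 := hEu b hb
    have e2 := hEw b hb
    have hiu : IntervalIntegrable Φu volume 0 b :=
      (intervalIntegrable_iff_integrableOn_Ioo_of_le hb.1.le).2
        (hΦu_int.mono_set (Ioo_subset_Ioo le_rfl hb.2))
    have hiw : IntervalIntegrable Φw volume 0 b :=
      (intervalIntegrable_iff_integrableOn_Ioo_of_le hb.1.le).2
        (hΦw_int.mono_set (Ioo_subset_Ioo le_rfl hb.2))
    have e3 : ∫ τ in (0 : ℝ)..b, Ψ τ = ((∫ τ in (0 : ℝ)..b, Φu τ) - ∫ τ in (0 : ℝ)..b, Φw τ) / 2 := by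
      simp only [hΨ]
      rw [intervalIntegral.integral_div, intervalIntegral.integral_sub hiu hiw]
    rw [e3, hpol b hbI, hpol 0 h0]
    simp only [hΦu, hΦw] at e1 e2 ⊢
    linarith
  -- hence `P s − P t = ∫ₜˢ Ψ`
  have htI : t ∈ Ioc 0 S := ⟨ht, (hts.trans hsS).le⟩
  have hsI : s ∈ Ioc 0 S := ⟨ht.trans hts, hsS.le⟩
  have hΨii : ∀ a b : ℝ, 0 ≤ a → b ≤ S → a ≤ b → IntervalIntegrable Ψ volume a b :=
    fun a b ha hb hab =>
      (intervalIntegrable_iff_integrableOn_Ioo_of_le hab).2 (hΨ_int.mono_set (Ioo_subset_Ioo ha hb))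
  have hPst : P s - P t = ∫ τ in Ioo t s, Ψ τ := by
    have h1 := hincr s hsI
    have h2 := hincr t htI
    have h3 := intervalIntegral.integral_interval_sub_left (hΨii 0 s le_rfl hsI.2 hsI.1.le)
      (hΨii 0 t le_rfl htI.2 htI.1.le)
    rw [intervalIntegral.integral_of_le hts.le, integral_Ioc_eq_integral_Ioo] at h3
    linarith
  -- the integrand: `Ψ τ = ∫⟪U, ∂ₜu τ⟫` on `[0,S]`, and its bound at interior times
  have hΨeq : ∀ τ ∈ Icc 0 S, Ψ τ = ∫ x, ⟪U x, W τ x⟫ := by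
    intro τ hτ
    have iu : Integrable (fun x => 2 * ⟪u τ x, timeDerivWithin (Icc 0 S) u τ x⟫) volume := by
      refine (integrable_of_norm_le_mul_of_lintegral_sq ((cut τ hτ).inner (cWt τ hτ)).aestronglyMeasurable
        (cut τ hτ) (cWt τ hτ) (l2sl τ hτ) (l2Wt τ hτ) fun x => norm_inner_le_norm _ _).const_mul 2
    have cwt : Continuous (w τ) := (hwsm.contDiff_slice hτ).continuous
    have l2wt : ∫⁻ x, ‖w τ x‖ₑ ^ 2 < ⊤ := (hwL2 τ hτ).trans_lt ENNReal.coe_lt_top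
    have iw : Integrable (fun x => 2 * ⟪w τ x, timeDerivWithin (Icc 0 S) w τ x⟫) volume := by
      have h1 : Integrable (fun x => ⟪w τ x, W τ x⟫) volume :=
        integrable_of_norm_le_mul_of_lintegral_sq (cwt.inner (cWt τ hτ)).aestronglyMeasurable
          cwt (cWt τ hτ) l2wt (l2Wt τ hτ) fun x => norm_inner_le_norm _ _
      refine (h1.const_mul 2).congr (Eventually.of_forall fun x => ?_)
      simp only [hWt τ hτ x]
    simp only [hΨ, hΦu, hΦw]
    rw [← integral_sub iu iw]
    have hpt : (fun x => 2 * ⟪u τ x, timeDerivWithin (Icc 0 S) u τ x⟫ -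
        2 * ⟪w τ x, timeDerivWithin (Icc 0 S) w τ x⟫) = fun x => 2 * ⟪U x, W τ x⟫ := by
      funext x
      rw [hWt τ hτ x, hwtx, inner_sub_left, real_inner_comm (W τ x) (U x)]
      simp only [hWdef]
      ring
    rw [hpt, integral_const_mul]
    ring
  -- the pointwise-in-time bound on `(t,s)`
  set a : ℝ := (ν + 1) / 2 * η with ha
  set K : ℝ := (ν * (∫ x, frobeniusNormSq (fderiv ℝ U x)) + L ^ 2 * I₀) / (2 * η) with hK
  set F : ℝ → ℝ≥0∞ := fun τ => ∫⁻ x, ENNReal.ofReal (frobeniusNormSq (fderiv ℝ (u τ) x)) with hF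
  have ha0 : 0 ≤ a := by rw [ha]; positivity
  have hI₀0 : 0 ≤ I₀ := (integral_nonneg fun x => sq_nonneg _).trans (hI₀le t ⟨ht.le, htI.2⟩)
  have hK0 : 0 ≤ K := by
    rw [hK]
    have : 0 ≤ ∫ x, frobeniusNormSq (fderiv ℝ U x) := integral_nonneg fun x => frobeniusNormSq_nonneg _
    positivity
  have hbound : ∀ τ ∈ Ioo t s, ENNReal.ofReal ‖Ψ τ‖ ≤ ENNReal.ofReal a * F τ + ENNReal.ofReal K := by
    intro τ hτ
    have hτS : τ ∈ Ioo 0 S := ⟨ht.trans hτ.1, hτ.2.trans hsS⟩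
    have hτS' : τ ∈ Icc 0 S := Ioo_subset_Icc_self hτS
    have hest := pairing_timeDeriv_abs_le_of_classical hν hS hsol hB hI₀le hτS hU1 hdivU hL l2U
      l2DU hη
    rw [← hΨeq τ hτS'] at hest
    -- `∫ frobeniusNormSq = (F τ).toReal`
    have hGeq : ∫ x, frobeniusNormSq (fderiv ℝ (u τ) x) = (F τ).toReal :=
      integral_eq_lintegral_of_nonneg_ae (Eventually.of_forall fun x => frobeniusNormSq_nonneg _)
        (continuous_frobeniusNormSq_fderiv (hu τ hτS') (by simp)).aestronglyMeasurable
    have hFfin : F τ ≠ ⊤ := by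
      obtain ⟨C₁, hC₁⟩ := hB 1
      refine (lt_of_le_of_lt ?_ (ENNReal.mul_lt_top (by norm_num : (3 : ℝ≥0∞) < ⊤)
        ((hC₁ τ hτS').trans_lt ENNReal.coe_lt_top))).ne
      calc F τ ≤ ∫⁻ x, 3 * ‖fderiv ℝ (u τ) x‖ₑ ^ 2 :=
            lintegral_mono fun x => ofReal_frobeniusNormSq_le_three_mul_enorm_sq _
        _ = 3 * ∫⁻ x, ‖fderiv ℝ (u τ) x‖ₑ ^ 2 := lintegral_const_mul' _ _ (by norm_num)
        _ = 3 * ∫⁻ x, ‖iteratedFDeriv ℝ 1 (u τ) x‖ₑ ^ 2 := by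
            congr 1
            exact lintegral_congr fun x => by
              rw [← ofReal_norm, ← ofReal_norm, ← norm_iteratedFDeriv_fderiv, norm_iteratedFDeriv_zero]
    rw [Real.norm_eq_abs]
    calc ENNReal.ofReal |Ψ τ|
        ≤ ENNReal.ofReal (a * (F τ).toReal + K) := by
          refine ENNReal.ofReal_le_ofReal ?_
          rw [ha, hK, ← hGeq]
          exact hest
      _ = ENNReal.ofReal a * F τ + ENNReal.ofReal K := by
          rw [ENNReal.ofReal_add (by positivity) hK0, ENNReal.ofReal_mul ha0,
            ENNReal.ofReal_toReal hFfin]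
  -- integrate the bound over `(t,s)`
  have hlin : ∫⁻ τ in Ioo t s, ENNReal.ofReal ‖Ψ τ‖ ≤
      ENNReal.ofReal a * (∫⁻ τ in Ioo t s, F τ) + ENNReal.ofReal K * ENNReal.ofReal (s - t) := by
    calc ∫⁻ τ in Ioo t s, ENNReal.ofReal ‖Ψ τ‖
        ≤ ∫⁻ τ in Ioo t s, (ENNReal.ofReal a * F τ + ENNReal.ofReal K) :=
          setLIntegral_mono' measurableSet_Ioo fun τ hτ => hbound τ hτ
      _ = ENNReal.ofReal a * (∫⁻ τ in Ioo t s, F τ) + ENNReal.ofReal K * ENNReal.ofReal (s - t) := by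
          rw [lintegral_add_right _ measurable_const, lintegral_const_mul' _ _ ENNReal.ofReal_ne_top,
            lintegral_const, Measure.restrict_apply MeasurableSet.univ, univ_inter, Real.volume_Ioo]
  have hDfin : (∫⁻ τ in Ioo t s, F τ) ≠ ⊤ := by
    -- `F ≤ 3 C₁` on the slab, so the integral over `(t,s)` is finite
    obtain ⟨C₁, hC₁⟩ := hB 1
    have hle : ∀ τ ∈ Ioo t s, F τ ≤ 3 * (C₁ : ℝ≥0∞) := by
      intro τ hτ
      have hτS' : τ ∈ Icc 0 S := ⟨(ht.trans hτ.1).le, (hτ.2.trans hsS).le⟩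
      calc F τ ≤ ∫⁻ x, 3 * ‖fderiv ℝ (u τ) x‖ₑ ^ 2 :=
            lintegral_mono fun x => ofReal_frobeniusNormSq_le_three_mul_enorm_sq _
        _ = 3 * ∫⁻ x, ‖fderiv ℝ (u τ) x‖ₑ ^ 2 := lintegral_const_mul' _ _ (by norm_num)
        _ ≤ 3 * (C₁ : ℝ≥0∞) := by
            refine mul_le_mul' le_rfl ((le_of_eq (lintegral_congr fun x => ?_)).trans (hC₁ τ hτS'))
            rw [← ofReal_norm, ← ofReal_norm, ← norm_iteratedFDeriv_fderiv, norm_iteratedFDeriv_zero]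
    refine (lt_of_le_of_lt (setLIntegral_mono' measurableSet_Ioo fun τ hτ => hle τ hτ) ?_).ne
    rw [lintegral_const, Measure.restrict_apply MeasurableSet.univ, univ_inter, Real.volume_Ioo]
    exact ENNReal.mul_lt_top (ENNReal.mul_lt_top (by norm_num) ENNReal.coe_lt_top) ENNReal.ofReal_lt_top
  -- conclude
  have hnorm := norm_integral_le_lintegral_norm (μ := volume.restrict (Ioo t s)) Ψ
  rw [Real.norm_eq_abs] at hnorm
  have hfinR : ENNReal.ofReal a * (∫⁻ τ in Ioo t s, F τ) + ENNReal.ofReal K * ENNReal.ofReal (s - t) ≠ ⊤ :=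
    ENNReal.add_ne_top.2 ⟨ENNReal.mul_ne_top ENNReal.ofReal_ne_top hDfin,
      ENNReal.mul_ne_top ENNReal.ofReal_ne_top ENNReal.ofReal_ne_top⟩
  have htoReal : (∫⁻ τ in Ioo t s, ENNReal.ofReal ‖Ψ τ‖).toReal ≤
      a * (∫⁻ τ in Ioo t s, F τ).toReal + K * (s - t) := by
    have h := (ENNReal.toReal_le_toReal (ne_top_of_le_ne_top hfinR hlin) hfinR).2 hlin
    rw [ENNReal.toReal_add (ENNReal.mul_ne_top ENNReal.ofReal_ne_top hDfin)
      (ENNReal.mul_ne_top ENNReal.ofReal_ne_top ENNReal.ofReal_ne_top), ENNReal.toReal_mul,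
      ENNReal.toReal_mul, ENNReal.toReal_ofReal ha0, ENNReal.toReal_ofReal hK0,
      ENNReal.toReal_ofReal (by linarith)] at h
    exact h
  simp only [hP] at hPst
  rw [hPst]
  exact hnorm.trans htoReal

/-! ### In the frame: the pairing rate against a regular terminal value -/

/-- **The pairing estimate in the frame.** `(u,p)` classical on `[0,T)` (`ν, T > 0`), Leray–Hopf on
`[0,T]` from a rapidly decaying datum, and the terminal value `U = u(T)` REGULAR (smooth, bounded by
`L`, divergence free, `DU ∈ L²`). Then for every `η > 0` and `t ∈ (0,T)`:
`|∫⟪u(t) − u(T), u(T)⟫| ≤ ((ν+1)/2) η (∫⁻_{(t,T)}∫⁻|Du|²_F).toReal + ((ν∫|Du(T)|²_F + 4L²E(u 0))… `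
precisely with `I₀ = 2E(u 0)`: `… + ((ν∫|DU|²_F + L²·2E(u 0))/(2η)) (T − t)`. Proof:
`pair_increment_abs_le_slab` on `[0,(s+T)/2]` for `t < s < T`, then `s ↑ T` by the weak continuity
of the Leray–Hopf structure at `T`. [folklore] -/
theorem pair_abs_le {ν T : ℝ} (hν : 0 < ν) (hT : 0 < T)
    {u : ℝ → EuclideanSpace ℝ (Fin 3) → EuclideanSpace ℝ (Fin 3)} {p : ℝ → EuclideanSpace ℝ (Fin 3) → ℝ}
    (hcl : IsClassicalNSSolutionOn (Ico 0 T) ν 0 u p) (hLH : IsLerayHopfOn T ν 0 (u 0) u)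
    (hdec : HasRapidSpatialDecay (u 0))
    (hUs : ContDiff ℝ ∞ (u T)) (hdivU : VectorCalculus.IsDivFree (u T)) {L : ℝ}
    (hL : ∀ x, ‖u T x‖ ≤ L) (l2DU : ∫⁻ x, ‖fderiv ℝ (u T) x‖ₑ ^ 2 < ⊤)
    {η : ℝ} (hη : 0 < η) {t : ℝ} (ht : t ∈ Ioo 0 T) :
    |∫ x, ⟪u t x - u T x, u T x⟫| ≤
      (ν + 1) / 2 * η *
          (∫⁻ τ in Ioo t T, ∫⁻ x, ENNReal.ofReal (frobeniusNormSq (fderiv ℝ (u τ) x))).toReal +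
        (ν * (∫ x, frobeniusNormSq (fderiv ℝ (u T) x)) + L ^ 2 * (2 * VectorCalculus.kineticEnergy (u 0))) /
          (2 * η) * (T - t) := by
  set U := u T with hUdef
  have hmT : MemLp U 2 volume := hLH.memLp T ⟨hT.le, le_rfl⟩
  have l2U : ∫⁻ x, ‖U x‖ₑ ^ 2 < ⊤ := by
    have h := hLH.lintegral_enorm_sq_le hν.le ⟨hT.le, le_rfl⟩
    exact h.trans_lt ENNReal.ofReal_lt_top
  set I₀ : ℝ := 2 * VectorCalculus.kineticEnergy (u 0) with hI₀
  have hI₀le : ∀ τ ∈ Icc 0 T, ∫ x, ‖u τ x‖ ^ 2 ≤ I₀ := by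
    intro τ hτ
    have h := CertifiedBlowupAxisymBlowup.EnergyDrain.kineticEnergy_antitoneOn hν hcl hLH
      ⟨le_rfl, hT.le⟩ hτ hτ.1
    have h2 : ∫ x, ‖u τ x‖ ^ 2 = 2 * VectorCalculus.kineticEnergy (u τ) := by
      simp only [VectorCalculus.kineticEnergy]; ring
    rw [h2, hI₀]
    simp only at h
    linarith
  set D : ℝ≥0∞ := ∫⁻ τ in Ioo t T, ∫⁻ x, ENNReal.ofReal (frobeniusNormSq (fderiv ℝ (u τ) x)) with hD
  have hDfin : D ≠ ⊤ := by
    have h := (CertifiedBlowupAxisymBlowup.EnergyDrain.dissipation_le_energy_sub hν hcl hLH ht.1.le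
      ht.2.le le_rfl).1
    exact h
  set K : ℝ := (ν * (∫ x, frobeniusNormSq (fderiv ℝ U x)) + L ^ 2 * I₀) / (2 * η) with hK
  -- the increment bound for every `s ∈ (t, T)`
  have hincr : ∀ s ∈ Ioo t T, |(∫ x, ⟪u s x, U x⟫) - ∫ x, ⟪u t x, U x⟫| ≤
      (ν + 1) / 2 * η * D.toReal + K * (T - t) := by
    intro s hs
    set S : ℝ := (s + T) / 2 with hSdef
    have hsS : s < S := by rw [hSdef]; linarith [hs.2]
    have hST : S < T := by rw [hSdef]; linarith [hs.2]
    have hS : 0 < S := (ht.1.trans hs.1).trans hsS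
    have hsolS : IsClassicalNSSolutionOn (Icc 0 S) ν 0 u p :=
      hcl.mono (Icc_subset_Ico_right hST) (uniqueDiffOn_Icc hS)
    have hE' : ∃ C' : ℝ≥0, ∀ τ ∈ Icc 0 S, ∫⁻ x, ‖u τ x‖ₑ ^ 2 ≤ C' :=
      ⟨(ENNReal.ofReal (2 * VectorCalculus.kineticEnergy (u 0))).toNNReal, fun τ hτ => by
        rw [ENNReal.coe_toNNReal ENNReal.ofReal_ne_top]
        exact hLH.lintegral_enorm_sq_le hν.le ⟨hτ.1, hτ.2.trans hST.le⟩⟩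
    have hB : HasBoundedSobolevNormsOn (Icc 0 S) u :=
      tao2011_hasBoundedSobolevNormsOn_holds hν hS hsolS hE' hdec
    have h := pair_increment_abs_le_slab hν hS hsolS hB (fun τ hτ => hI₀le τ ⟨hτ.1, hτ.2.trans hST.le⟩)
      hUs hdivU hL l2U l2DU ht.1 hs.1 hsS hη
    have hmono : (∫⁻ τ in Ioo t s, ∫⁻ x, ENNReal.ofReal (frobeniusNormSq (fderiv ℝ (u τ) x))).toReal ≤
        D.toReal :=
      ENNReal.toReal_mono hDfin (lintegral_mono_set (Ioo_subset_Ioo_right hs.2.le))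
    have hK0 : 0 ≤ K := by
      rw [hK]
      have : 0 ≤ ∫ x, frobeniusNormSq (fderiv ℝ U x) :=
        integral_nonneg fun x => frobeniusNormSq_nonneg _
      have hI₀0 : 0 ≤ I₀ := by rw [hI₀]; linarith [kineticEnergy_nonneg (u 0)]
      positivity
    have h2 : K * (s - t) ≤ K * (T - t) := mul_le_mul_of_nonneg_left (by linarith [hs.2]) hK0
    have h1 : (ν + 1) / 2 * η *
        (∫⁻ τ in Ioo t s, ∫⁻ x, ENNReal.ofReal (frobeniusNormSq (fderiv ℝ (u τ) x))).toReal ≤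
        (ν + 1) / 2 * η * D.toReal := mul_le_mul_of_nonneg_left hmono (by positivity)
    rw [← hK] at h
    linarith
  -- pass to the limit `s ↑ T` (weak continuity of the Leray–Hopf structure)
  have hlim : Tendsto (fun s => (∫ x, ⟪u s x, U x⟫) - ∫ x, ⟪u t x, U x⟫) (𝓝[<] T)
      (𝓝 ((∫ x, ‖U x‖ ^ 2) - ∫ x, ⟪u t x, U x⟫)) :=
    (tendsto_integral_inner_terminal hT hLH).sub tendsto_const_nhds
  have hev : ∀ᶠ s in 𝓝[<] T, |(∫ x, ⟪u s x, U x⟫) - ∫ x, ⟪u t x, U x⟫| ≤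
      (ν + 1) / 2 * η * D.toReal + K * (T - t) := by
    filter_upwards [Ioo_mem_nhdsLT ht.2] with s hs
    exact hincr s hs
  have hle := le_of_tendsto (hlim.abs) hev
  -- identify the pairing
  have hmt : MemLp (u t) 2 volume := hLH.memLp t ⟨ht.1.le, ht.2.le⟩
  have hpair : ∫ x, ⟪u t x - U x, U x⟫ = (∫ x, ⟪u t x, U x⟫) - ∫ x, ‖U x‖ ^ 2 := by
    rw [← integral_sub (integrable_inner_of_memLp_two hmt hmT) (hmT.integrable_norm_pow two_ne_zero)]
    refine integral_congr_ae (Eventually.of_forall fun x => ?_)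
    simp only [inner_sub_left, real_inner_self_eq_norm_sq]
  rw [hpair, abs_sub_comm]
  exact hle

end NoTerminalJolt

end Summit.NavierStokesRegularity.NavierStokesRegularity.Theorems

end
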